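import Summits.AtomisticToContinuum.HydrodynamicLimit.Theses.UGibbsSRBRigidity

/-!
# Birth skeleton for crux `GaussianTails` (stmt-AtomisticToContinuum-14415) of route
`UGibbsSRBRigidity` — line `birth`: SUB-GAUSSIAN SPEED TAILS AS THE CURRENCY

The crux (N-uniform Gaussian velocity MOMENTS `E[(N+1)⁻¹ Σ exp(c|vᵢ(s)|²)] ≤ C` along the true
hard-sphere evolution from local Gibbs data, in the smooth Euler regime; Nachtergaele–Yau's
Assumption II.1 transcribed and guarded) is reached from three stubs:

* `stub_initialTails` (t = 0 input, provable now, size M/L): under the local Gibbs law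
  `λ^N = localGibbsLaw σ a₀ u₀ θ₀ N Φ` the velocities are, given the positions, independent Gaussians
  `N(u₀(xᵢ), θ₀(xᵢ) I₃)` with `θ₀ ≤ max θ₀ < ∞`, `|u₀| ≤ max |u₀|` (continuity on the compact torus);
  hence for `κ < 1/(2 max θ₀)` the summed one-particle speed tails are sub-Gaussian UNIFORMLY in
  `σ, N, Φ` and the positions: `Σᵢ λ^N{k ≤ |vᵢ|} ≤ (N+1)·C·e^{-κk²}` for every level `k ∈ ℕ`
  (the level `k = 0` is the mass bound `λ^N(univ) ≤ C`, true since `λ^N` is a probability law or,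
  by the junk value of `canonicalDensity`, the zero measure).
* `stub_tailPropagation` (the OPEN CORE, the route's rank-7 difficulty in its natural currency):
  PROPAGATION of N-uniform sub-Gaussian speed tails of the mean one-particle law along the
  deterministic flow, for `N ≥ N₀`, at all times `s ≤ t < T` below the classical Euler horizon,
  given the t = 0 tails and the LLN at t = 0 (the only tie between the profiles and the Euler
  solution). Tail probabilities — not exponential moments — are what every candidate mechanism
  produces: energy-funnelling large deviations (to load energy `kθ` on one sphere needs `≍ k`
  favourable collisions), max-speed / one-rare-participant counting (SpeedCapSurgery's
  TailsToMaxSpeedR), Maxwellian comparison principles (Gamba–Panferov–Villani 2009 at the kinetic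
  level), Povzner moment hierarchies in the mean (the AprioriTailsRattlers module; its
  ContactIntensityDomination stmt-9218 is REFUTED-misstated, negatives index) — all end in
  `P(|vᵢ(s)| ≥ R) ≤ C e^{-κR²}`-type statements, Chebyshev being the last step of each.
* `stub_tailToMoment` (pure measure theory, provable now, size M): sub-Gaussian tails at rate `κ`
  of the summed one-particle speed laws of ANY measure pushed through ANY measurable configuration
  map give the exponential moment of every order `c < κ`, with a constant `C·K(c,κ)` that does not
  depend on `N` (shell decomposition `e^{cr²} ≤ Σₖ 1[k ≤ r] e^{c(k+1)²}`, Tonelli, and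
  `K = Σₖ e^{c(k+1)² - κk²} < ∞`).

`gaussianTails_of_stubSigs : stub₁-sig → stub₂-sig → stub₃-sig → (crux body)` is the kernel-checked
composition (c := κ/2, no sorry) and `GaussianTails_of : GaussianTails` THE skeleton theorem (the crux by
name from the three declared stubs). Sorries: exactly the three stubs.
Disproof used: none on file for this crux (no `Disproof.lean`, `ledger crux ls` 2026-08-17); the
negatives index entries ExpTailBudget (stmt-14607: exponential-IN-N probability bound on cubic
tails, false at t = 0) and ContactIntensityDomination (stmt-9218) are not instances of any stub:
the tail bounds here are LINEAR in `N + 1` (one Gaussian outlier has probability `≍ (N+1)e^{-k²/2θ}`).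
-/

namespace Summit.AtomisticToContinuum.HydrodynamicLimit.Cruxes.GaussianTails.Birth

open MeasureTheory
open scoped ENNReal

/-- **Stub 1 (t = 0 input): sub-Gaussian speed tails under the local Gibbs law, uniformly in the
reduced diameter, the particle number, the flow (which only fixes the phase space) and the level.**
For continuous profiles `a₀, θ₀ > 0`, `u₀` there are `κ > 0` and `C < ∞` with
`Σᵢ λ^N_{σ}{z | k ≤ |vᵢ|} ≤ (N+1) C e^{-κ k²}` for all `σ`, `N`, `Φ` and `k ∈ ℕ`
(`k = 0`: total mass `≤ C`). Gaussian velocities given the positions; `κ < 1/(2 max θ₀)`. -/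
theorem stub_initialTails :
    ∀ (a₀ θ₀ : Literature.MathematicalPhysics.KineticTheory.T3 → ℝ)
      (u₀ : Literature.MathematicalPhysics.KineticTheory.T3 → Literature.MathematicalPhysics.KineticTheory.V3),
      Continuous a₀ → Continuous θ₀ → Continuous u₀ → (∀ x, 0 < a₀ x) → (∀ x, 0 < θ₀ x) →
      ∃ κ : ℝ, 0 < κ ∧ ∃ C : ℝ≥0∞, C < ⊤ ∧
        ∀ (σ : ℝ) (N : ℕ)
          (Φ : Literature.Analysis.FluidPDE.HardSphereFlow
            (Literature.Analysis.FluidPDE.Torus.geometry (Fin 3))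
            (Literature.MathematicalPhysics.KineticTheory.hsDiameter σ N) (N + 1))
          (k : ℕ),
          (∑ i : Fin (N + 1),
              Literature.MathematicalPhysics.KineticTheory.localGibbsLaw σ a₀ u₀ θ₀ N Φ
                {z | (k : ℝ) ≤ ‖(z i).2‖}) ≤
            ((N : ℝ≥0∞) + 1) * C * ENNReal.ofReal (Real.exp (-(κ * (k : ℝ) ^ 2))) := by
  sorry

/-- **Stub 2 (OPEN CORE): propagation of N-uniform sub-Gaussian speed tails along the true
hard-sphere evolution in the smooth Euler regime.** For continuous profiles, GIVEN t = 0 tails at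
some rate `κ₀` with constant `C₀` (Stub 1), there is `σ₀ > 0` such that for `0 < σ < σ₀`, every
classical hs-Euler solution on `[0, T)`, every flow family whose local Gibbs laws satisfy the LLN
towards the solution at `t = 0`, and every `t < T`, there are `κ > 0`, `C < ∞`, `N₀` with
`Σᵢ λ^N{z | k ≤ |vᵢ(Φ_N(s) z)|} ≤ (N+1) C e^{-κk²}` for all `N ≥ N₀`, `s ∈ [0, t]`, `k ∈ ℕ`. -/
theorem stub_tailPropagation :
    ∀ (a₀ θ₀ : Literature.MathematicalPhysics.KineticTheory.T3 → ℝ)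
      (u₀ : Literature.MathematicalPhysics.KineticTheory.T3 → Literature.MathematicalPhysics.KineticTheory.V3),
      Continuous a₀ → Continuous θ₀ → Continuous u₀ → (∀ x, 0 < a₀ x) → (∀ x, 0 < θ₀ x) →
      ∀ κ₀ : ℝ, 0 < κ₀ → ∀ C₀ : ℝ≥0∞, C₀ < ⊤ →
      (∀ (σ : ℝ) (N : ℕ)
          (Φ : Literature.Analysis.FluidPDE.HardSphereFlow
            (Literature.Analysis.FluidPDE.Torus.geometry (Fin 3))
            (Literature.MathematicalPhysics.KineticTheory.hsDiameter σ N) (N + 1))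
          (k : ℕ),
          (∑ i : Fin (N + 1),
              Literature.MathematicalPhysics.KineticTheory.localGibbsLaw σ a₀ u₀ θ₀ N Φ
                {z | (k : ℝ) ≤ ‖(z i).2‖}) ≤
            ((N : ℝ≥0∞) + 1) * C₀ * ENNReal.ofReal (Real.exp (-(κ₀ * (k : ℝ) ^ 2)))) →
      ∃ σ₀ : ℝ, 0 < σ₀ ∧ ∀ σ : ℝ, 0 < σ → σ < σ₀ →
        ∀ (T : ℝ) (ρ θ : ℝ → Literature.MathematicalPhysics.KineticTheory.T3 → ℝ)
          (u : ℝ → Literature.MathematicalPhysics.KineticTheory.T3 → Literature.MathematicalPhysics.KineticTheory.V3),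
          Literature.MathematicalPhysics.KineticTheory.IsHardSphereEulerSolution σ T ρ u θ →
          ∀ Φ : (N : ℕ) → Literature.Analysis.FluidPDE.HardSphereFlow
              (Literature.Analysis.FluidPDE.Torus.geometry (Fin 3))
              (Literature.MathematicalPhysics.KineticTheory.hsDiameter σ N) (N + 1),
            Literature.MathematicalPhysics.KineticTheory.TendstoHydroFieldsAt
                (fun N => Literature.MathematicalPhysics.KineticTheory.localGibbsLaw σ a₀ u₀ θ₀ N (Φ N))
                Φ ρ u θ 0 →
            ∀ t ∈ Set.Ico 0 T, ∃ κ : ℝ, 0 < κ ∧ ∃ C : ℝ≥0∞, C < ⊤ ∧ ∃ N₀ : ℕ, ∀ N : ℕ, N₀ ≤ N →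
              ∀ s ∈ Set.Icc 0 t, ∀ k : ℕ,
                (∑ i : Fin (N + 1),
                    Literature.MathematicalPhysics.KineticTheory.localGibbsLaw σ a₀ u₀ θ₀ N (Φ N)
                      {z | (k : ℝ) ≤ ‖((Φ N).flow s z i).2‖}) ≤
                  ((N : ℝ≥0∞) + 1) * C * ENNReal.ofReal (Real.exp (-(κ * (k : ℝ) ^ 2))) := by
  sorry

/-- **Stub 3 (conversion, pure measure theory): sub-Gaussian tails at rate `κ` of the summed
one-particle speed laws give the empirical exponential velocity moment of every order `c < κ`,
with an `N`-independent constant.** For `0 < c < κ` there is `K = K(c, κ) < ∞` such that for every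
`N`, every measure `μ` on the `(N+1)`-sphere phase space over `𝕋³`, every measurable configuration
map `F` and every `C`: if `Σᵢ μ{z | k ≤ |(F z)ᵢ.v|} ≤ (N+1) C e^{-κk²}` for all `k ∈ ℕ`, then
`∫⁻ expVelocityMoment c (F z) dμ ≤ C K` (shells `e^{cr²} ≤ Σₖ 1[k ≤ r] e^{c(k+1)²}`, Tonelli,
`K = Σₖ e^{c(k+1)² - κk²}`). -/
theorem stub_tailToMoment :
    ∀ (κ c : ℝ), 0 < c → c < κ → ∃ K : ℝ≥0∞, K < ⊤ ∧
      ∀ (N : ℕ)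
        (μ : Measure (Literature.Analysis.FluidPDE.Config (N + 1) (Fin 3)
          Literature.MathematicalPhysics.KineticTheory.T3))
        (F : Literature.Analysis.FluidPDE.Config (N + 1) (Fin 3) Literature.MathematicalPhysics.KineticTheory.T3 →
          Literature.Analysis.FluidPDE.Config (N + 1) (Fin 3) Literature.MathematicalPhysics.KineticTheory.T3),
        Measurable F → ∀ C : ℝ≥0∞,
          (∀ k : ℕ, (∑ i : Fin (N + 1), μ {z | (k : ℝ) ≤ ‖(F z i).2‖}) ≤
              ((N : ℝ≥0∞) + 1) * C * ENNReal.ofReal (Real.exp (-(κ * (k : ℝ) ^ 2)))) →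
          (∫⁻ z, Literature.Barriers.AtomisticToContinuum.expVelocityMoment c (F z) ∂μ) ≤ C * K := by
  sorry

/-- **Composition with explicit hypotheses (kernel-checked, no sorry): the BC3 shape
`stub₁-sig → stub₂-sig → stub₃-sig → crux`, the conclusion written as the crux's ONE-STEP UNFOLDING
(the body of `UGibbsSRBRigidity.GaussianTails`, verbatim) so that `GaussianTails_of` below is the
file's only theorem whose head is the crux name, as `ledger skeleton check` requires.** Take
`(κ₀, C₀)` from Stub 1, `σ₀` from Stub 2; for `σ < σ₀`, a classical solution, a flow family with the
LLN at `0` and `t < T` take `(κ, C, N₀)` from Stub 2, set `c := κ/2` and the constant `C · K(κ/2, κ)`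
from Stub 3 applied to `μ := λ^N`, `F := Φ_N(s)` (measurable: `HardSphereFlow.measurable_flow`). -/
theorem gaussianTails_of_stubSigs :
    (∀ (a₀ θ₀ : Literature.MathematicalPhysics.KineticTheory.T3 → ℝ)
      (u₀ : Literature.MathematicalPhysics.KineticTheory.T3 → Literature.MathematicalPhysics.KineticTheory.V3),
      Continuous a₀ → Continuous θ₀ → Continuous u₀ → (∀ x, 0 < a₀ x) → (∀ x, 0 < θ₀ x) →
      ∃ κ : ℝ, 0 < κ ∧ ∃ C : ℝ≥0∞, C < ⊤ ∧
        ∀ (σ : ℝ) (N : ℕ)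
          (Φ : Literature.Analysis.FluidPDE.HardSphereFlow
            (Literature.Analysis.FluidPDE.Torus.geometry (Fin 3))
            (Literature.MathematicalPhysics.KineticTheory.hsDiameter σ N) (N + 1))
          (k : ℕ),
          (∑ i : Fin (N + 1),
              Literature.MathematicalPhysics.KineticTheory.localGibbsLaw σ a₀ u₀ θ₀ N Φ
                {z | (k : ℝ) ≤ ‖(z i).2‖}) ≤
            ((N : ℝ≥0∞) + 1) * C * ENNReal.ofReal (Real.exp (-(κ * (k : ℝ) ^ 2)))) →
    (∀ (a₀ θ₀ : Literature.MathematicalPhysics.KineticTheory.T3 → ℝ)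
      (u₀ : Literature.MathematicalPhysics.KineticTheory.T3 → Literature.MathematicalPhysics.KineticTheory.V3),
      Continuous a₀ → Continuous θ₀ → Continuous u₀ → (∀ x, 0 < a₀ x) → (∀ x, 0 < θ₀ x) →
      ∀ κ₀ : ℝ, 0 < κ₀ → ∀ C₀ : ℝ≥0∞, C₀ < ⊤ →
      (∀ (σ : ℝ) (N : ℕ)
          (Φ : Literature.Analysis.FluidPDE.HardSphereFlow
            (Literature.Analysis.FluidPDE.Torus.geometry (Fin 3))
            (Literature.MathematicalPhysics.KineticTheory.hsDiameter σ N) (N + 1))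
          (k : ℕ),
          (∑ i : Fin (N + 1),
              Literature.MathematicalPhysics.KineticTheory.localGibbsLaw σ a₀ u₀ θ₀ N Φ
                {z | (k : ℝ) ≤ ‖(z i).2‖}) ≤
            ((N : ℝ≥0∞) + 1) * C₀ * ENNReal.ofReal (Real.exp (-(κ₀ * (k : ℝ) ^ 2)))) →
      ∃ σ₀ : ℝ, 0 < σ₀ ∧ ∀ σ : ℝ, 0 < σ → σ < σ₀ →
        ∀ (T : ℝ) (ρ θ : ℝ → Literature.MathematicalPhysics.KineticTheory.T3 → ℝ)
          (u : ℝ → Literature.MathematicalPhysics.KineticTheory.T3 → Literature.MathematicalPhysics.KineticTheory.V3),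
          Literature.MathematicalPhysics.KineticTheory.IsHardSphereEulerSolution σ T ρ u θ →
          ∀ Φ : (N : ℕ) → Literature.Analysis.FluidPDE.HardSphereFlow
              (Literature.Analysis.FluidPDE.Torus.geometry (Fin 3))
              (Literature.MathematicalPhysics.KineticTheory.hsDiameter σ N) (N + 1),
            Literature.MathematicalPhysics.KineticTheory.TendstoHydroFieldsAt
                (fun N => Literature.MathematicalPhysics.KineticTheory.localGibbsLaw σ a₀ u₀ θ₀ N (Φ N))
                Φ ρ u θ 0 →
            ∀ t ∈ Set.Ico 0 T, ∃ κ : ℝ, 0 < κ ∧ ∃ C : ℝ≥0∞, C < ⊤ ∧ ∃ N₀ : ℕ, ∀ N : ℕ, N₀ ≤ N →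
              ∀ s ∈ Set.Icc 0 t, ∀ k : ℕ,
                (∑ i : Fin (N + 1),
                    Literature.MathematicalPhysics.KineticTheory.localGibbsLaw σ a₀ u₀ θ₀ N (Φ N)
                      {z | (k : ℝ) ≤ ‖((Φ N).flow s z i).2‖}) ≤
                  ((N : ℝ≥0∞) + 1) * C * ENNReal.ofReal (Real.exp (-(κ * (k : ℝ) ^ 2)))) →
    (∀ (κ c : ℝ), 0 < c → c < κ → ∃ K : ℝ≥0∞, K < ⊤ ∧
      ∀ (N : ℕ)
        (μ : Measure (Literature.Analysis.FluidPDE.Config (N + 1) (Fin 3)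
          Literature.MathematicalPhysics.KineticTheory.T3))
        (F : Literature.Analysis.FluidPDE.Config (N + 1) (Fin 3) Literature.MathematicalPhysics.KineticTheory.T3 →
          Literature.Analysis.FluidPDE.Config (N + 1) (Fin 3) Literature.MathematicalPhysics.KineticTheory.T3),
        Measurable F → ∀ C : ℝ≥0∞,
          (∀ k : ℕ, (∑ i : Fin (N + 1), μ {z | (k : ℝ) ≤ ‖(F z i).2‖}) ≤
              ((N : ℝ≥0∞) + 1) * C * ENNReal.ofReal (Real.exp (-(κ * (k : ℝ) ^ 2)))) →
          (∫⁻ z, Literature.Barriers.AtomisticToContinuum.expVelocityMoment c (F z) ∂μ) ≤ C * K) →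
    (∀ (a₀ θ₀ : Literature.MathematicalPhysics.KineticTheory.T3 → ℝ) (u₀ :
      Literature.MathematicalPhysics.KineticTheory.T3 →
      Literature.MathematicalPhysics.KineticTheory.V3), Continuous a₀ → Continuous θ₀ → Continuous
      u₀ → (∀ x, 0 < a₀ x) → (∀ x, 0 < θ₀ x) → ∃ σ₀ : ℝ, 0 < σ₀ ∧ ∀ σ : ℝ, 0 < σ → σ < σ₀ → ∀ (T :
      ℝ) (ρ θ : ℝ → Literature.MathematicalPhysics.KineticTheory.T3 → ℝ) (u : ℝ →
      Literature.MathematicalPhysics.KineticTheory.T3 →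
      Literature.MathematicalPhysics.KineticTheory.V3),
      Literature.MathematicalPhysics.KineticTheory.IsHardSphereEulerSolution σ T ρ u θ → ∀ Φ : (N :
      ℕ) → Literature.Analysis.FluidPDE.HardSphereFlow (Literature.Analysis.FluidPDE.Torus.geometry
      (Fin 3)) (Literature.MathematicalPhysics.KineticTheory.hsDiameter σ N) (N + 1),
      Literature.MathematicalPhysics.KineticTheory.TendstoHydroFieldsAt (fun N =>
      Literature.MathematicalPhysics.KineticTheory.localGibbsLaw σ a₀ u₀ θ₀ N (Φ N)) Φ ρ u θ 0 → ∀ t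
      ∈ Set.Ico 0 T, ∃ c : ℝ, 0 < c ∧ ∃ C : ENNReal, C < ⊤ ∧ ∃ N₀ : ℕ, ∀ N : ℕ, N₀ ≤ N → ∀ s ∈
      Set.Icc 0 t, (∫⁻ z, Literature.Barriers.AtomisticToContinuum.expVelocityMoment c ((Φ N).flow s
      z) ∂(Literature.MathematicalPhysics.KineticTheory.localGibbsLaw σ a₀ u₀ θ₀ N (Φ N))) ≤ C) := by
  intro hInit hProp hConv a₀ θ₀ u₀ ha hθ hu ha0 hθ0
  obtain ⟨κ₀, hκ₀, C₀, hC₀, hT0⟩ := hInit a₀ θ₀ u₀ ha hθ hu ha0 hθ0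
  obtain ⟨σ₀, hσ₀, H⟩ := hProp a₀ θ₀ u₀ ha hθ hu ha0 hθ0 κ₀ hκ₀ C₀ hC₀ hT0
  refine ⟨σ₀, hσ₀, fun σ hσ hσ' T ρ θ u hsol Φ h0 t ht => ?_⟩
  obtain ⟨κ, hκ, C, hC, N₀, hN⟩ := H σ hσ hσ' T ρ θ u hsol Φ h0 t ht
  obtain ⟨K, hK, hKbound⟩ := hConv κ (κ / 2) (by positivity) (by linarith)
  refine ⟨κ / 2, by positivity, C * K, ENNReal.mul_lt_top hC hK, N₀, fun N hNN s hs => ?_⟩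
  exact hKbound N (Literature.MathematicalPhysics.KineticTheory.localGibbsLaw σ a₀ u₀ θ₀ N (Φ N))
    ((Φ N).flow s) ((Φ N).measurable_flow s) C (hN N hNN s hs)

/-- **THE SKELETON THEOREM: the crux `UGibbsSRBRigidity.GaussianTails` BY NAME from the three
DECLARED stubs** (the only `sorry`s of the file) through the sorry-free composition
`gaussianTails_of_stubSigs` (the crux `def` unfolds to the composition's conclusion). -/
theorem GaussianTails_of :
    Summit.AtomisticToContinuum.HydrodynamicLimit.Theses.UGibbsSRBRigidity.GaussianTails :=
  gaussianTails_of_stubSigs stub_initialTails stub_tailPropagation stub_tailToMoment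

end Summit.AtomisticToContinuum.HydrodynamicLimit.Cruxes.GaussianTails.Birth
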